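import Literature.NumberTheory.PAdicHodge.FontaineThetaKernel
import Mathlib.RingTheory.AdicCompletion.LocalRing
import Mathlib.RingTheory.Localization.Basic
import HarnessLib

/-!
# `θ[1/p] : 𝔸_inf(F)[1/p] → ℂ_F`: surjective with kernel `(ξ)`; `B_dR⁺(F)` is a complete local ring

Continuing `FontaineThetaKernel` (`ker θ = (ξ)`), we pass to `p` inverted (Fontaine 1994, Exp. II
§1.5; Fontaine–Ouyang §5.1):

* `isLocalization_away_C` : `ℂ_F = 𝒪_{ℂ_F}[1/p]` (the field `ℂ_F` is the localization of its unit
  ball away from `p`);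
* `fontaineThetaInvertP_surjective` : Mathlib's `θ[1/p] : 𝕎(𝒪_{ℂ_F}♭)[1/p] → 𝒪_{ℂ_F}[1/p]` is onto;
* `ker_fontaineThetaInvertP_eq_span` : **`ker θ[1/p] = (ξ)`**, hence finitely generated and —
  the target `𝒪_{ℂ_F}[1/p] ≅ ℂ_F` being a field — maximal (`isMaximal_ker_fontaineThetaInvertP`);
* consequences for `B_dR⁺ = (𝔸_inf[1/p])^_{ker θ[1/p]}` (Mathlib `BDeRhamPlus`): it is
  `ker θ[1/p]`-adically complete (`isAdicComplete_bDeRhamPlus`), the ideal generated by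
  `ker θ[1/p]` is maximal, and **`B_dR⁺` is a local ring** (`instIsLocalRingBDeRhamPlus`).

## References
* [FontaineAsterisque223III] J.-M. Fontaine, *Le corps des périodes p-adiques*, Astérisque 223
  (1994), Exp. II, §1.5.
* [FontaineOuyang2022] J.-M. Fontaine, Y. Ouyang, *Theory of p-adic Galois representations*
  (book draft), §5.1.
-/

noncomputable section

open ValuativeRel Field Ideal WittVector UniformSpace

namespace Literature.NumberTheory.PAdicHodge

open Literature.NumberTheory.GaloisRepresentations
open Literature.NumberTheory.GaloisRepresentations.IsNonarchimedeanLocalField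

variable {F : Type} [Field F] [ValuativeRel F] [TopologicalSpace F] [IsNonarchimedeanLocalField F]
  [CharZero F] {p : ℕ} [Fact p.Prime]

/-! ### `ℂ_F = 𝒪_{ℂ_F}[1/p]` -/

omit [CharZero F] [Fact p.Prime] in
/-- `algebraMap 𝒪_{ℂ_F} ℂ_F` is the inclusion. [folklore] -/
theorem algebraMap_integerC_apply (x : integerC F) :
    algebraMap (integerC F) (CompletedAlgClosure F) x = x := rfl

section Away

variable [Fact (¬ IsUnit (p : integerC F))]

/-- **`ℂ_F` is the localization of `𝒪_{ℂ_F}` away from `p`** (`char F = 0`, so `p ≠ 0`; every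
`z ∈ ℂ_F` satisfies `‖z pⁿ‖ ≤ 1` for `n ≫ 0` as `‖p‖ < 1`). [cite: FontaineOuyang2022, §5.1] -/
instance isLocalization_away_C : IsLocalization.Away (p : integerC F) (CompletedAlgClosure F) := by
  have hlt : ‖(p : CompletedAlgClosure F)‖ < 1 := norm_natCast_C_lt_one'
  have hp0 : (p : CompletedAlgClosure F) ≠ 0 := natCast_C_ne_zero (Fact.out : p.Prime).ne_zero
  rw [IsLocalization.Away, isLocalization_iff]
  refine ⟨?_, fun z => ?_, fun {x y} hxy => ⟨1, ?_⟩⟩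
  · rintro ⟨_, n, rfl⟩
    refine isUnit_iff_ne_zero.2 ?_
    rw [map_pow, map_natCast]
    exact pow_ne_zero _ hp0
  · by_cases hz : z = 0
    · exact ⟨(0, 1), by rw [hz, zero_mul, map_zero]⟩
    obtain ⟨n, hn⟩ := exists_pow_lt_of_lt_one (inv_pos.2 (norm_pos_iff.2 hz)) hlt
    have hmem : z * (p : CompletedAlgClosure F) ^ n ∈ integerC F := by
      rw [mem_integerC_iff, norm_mul, norm_pow]
      have h1 := mul_lt_mul_of_pos_left hn (norm_pos_iff.2 hz)
      rw [mul_inv_cancel₀ (norm_ne_zero_iff.2 hz)] at h1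
      exact h1.le
    refine ⟨(⟨_, hmem⟩, ⟨(p : integerC F) ^ n, n, rfl⟩), ?_⟩
    change z * algebraMap (integerC F) (CompletedAlgClosure F) ((p : integerC F) ^ n) = z * (p : CompletedAlgClosure F) ^ n
    rw [map_pow, map_natCast]
  · change ((x : integerC F) : CompletedAlgClosure F) = y at hxy
    rw [Subtype.coe_injective hxy]

/-! ### `θ[1/p]` is surjective with kernel `(ξ)` -/

variable [IsAdicComplete (Ideal.span {(p : integerC F)}) (integerC F)]

omit [CharZero F] in
/-- `θ[1/p]` on the fractions `x / pⁿ`. [folklore] -/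
theorem fontaineThetaInvertP_mk' (x : Ainf (p := p) F) (n : ℕ) :
    fontaineThetaInvertP (integerC F) p
        (IsLocalization.mk' (Localization.Away (p : Ainf (p := p) F)) x
          (⟨(p : Ainf (p := p) F) ^ n, n, rfl⟩ : Submonoid.powers (p : Ainf (p := p) F))) =
      IsLocalization.mk' (Localization.Away (p : integerC F)) (fontaineTheta (integerC F) p x)
        (⟨(p : integerC F) ^ n, n, rfl⟩ : Submonoid.powers (p : integerC F)) := by
  delta fontaineThetaInvertP Localization.awayLift IsLocalization.Away.lift
  rw [IsLocalization.lift_mk'_spec]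
  change algebraMap (integerC F) (Localization.Away (p : integerC F)) (fontaineTheta (integerC F) p x) =
    algebraMap (integerC F) (Localization.Away (p : integerC F)) (fontaineTheta (integerC F) p ((p : Ainf (p := p) F) ^ n)) * _
  rw [map_pow, map_natCast, IsLocalization.mk'_spec'_mk]

omit [CharZero F] in
/-- **`θ[1/p]` is surjective** (from the surjectivity of `θ`, file `FontaineThetaLocalField`).
[cite: FontaineAsterisque223III, Exp. II §1.5] -/
theorem fontaineThetaInvertP_surjective (hF : Function.Surjective (fontaineTheta (integerC F) p)) :
    Function.Surjective (fontaineThetaInvertP (integerC F) p) := by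
  intro z
  obtain ⟨⟨y, ⟨_, n, rfl⟩⟩, rfl⟩ := IsLocalization.mk'_surjective (Submonoid.powers (p : integerC F)) z
  obtain ⟨x, rfl⟩ := hF y
  exact ⟨IsLocalization.mk' _ x (⟨(p : Ainf (p := p) F) ^ n, n, rfl⟩ : Submonoid.powers (p : Ainf (p := p) F)),
    fontaineThetaInvertP_mk' x n⟩

/-- **`ker θ[1/p] = (ξ)`** in `𝔸_inf(F)[1/p]`: if `θ(x)/pⁿ = 0` then `p^k θ(x) = 0` for some `k`, so
`θ(x) = 0` (`𝒪_{ℂ_F}` has no `p`-torsion) and `x ∈ ξ𝔸_inf` (`ker_fontaineTheta_eq_span_xi`).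
[cite: FontaineAsterisque223III, Exp. II §1.5] [cite: FontaineOuyang2022, §5.1] -/
theorem ker_fontaineThetaInvertP_eq_span :
    RingHom.ker (fontaineThetaInvertP (integerC F) p) =
      Ideal.span {algebraMap (Ainf (p := p) F) (Localization.Away (p : Ainf (p := p) F)) xi} := by
  refine le_antisymm (fun z hz => ?_) ?_
  · obtain ⟨⟨x, ⟨_, n, rfl⟩⟩, rfl⟩ := IsLocalization.mk'_surjective (Submonoid.powers (p : Ainf (p := p) F)) z
    rw [RingHom.mem_ker] at hz
    change fontaineThetaInvertP (integerC F) p (IsLocalization.mk' _ x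
      (⟨(p : Ainf (p := p) F) ^ n, n, rfl⟩ : Submonoid.powers (p : Ainf (p := p) F))) = 0 at hz
    rw [fontaineThetaInvertP_mk', IsLocalization.mk'_eq_zero_iff] at hz
    obtain ⟨⟨_, k, rfl⟩, hk⟩ := hz
    change (p : integerC F) ^ k * fontaineTheta (integerC F) p x = 0 at hk
    have hx : fontaineTheta (integerC F) p x = 0 := by
      induction k with
      | zero => rwa [pow_zero, one_mul] at hk
      | succ k ih => rw [pow_succ', mul_assoc] at hk; exact ih (eq_zero_of_natCast_mul_eq_zero hk)
    obtain ⟨a, rfl⟩ := xi_dvd_of_fontaineTheta_eq_zero hx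
    change IsLocalization.mk' (Localization.Away (p : Ainf (p := p) F)) (xi * a)
      (⟨(p : Ainf (p := p) F) ^ n, n, rfl⟩ : Submonoid.powers (p : Ainf (p := p) F)) ∈ _
    rw [← IsLocalization.mul_mk'_eq_mk'_of_mul]
    exact Ideal.mul_mem_right _ _ (Ideal.mem_span_singleton_self _)
  · rw [Ideal.span_le, Set.singleton_subset_iff, SetLike.mem_coe, RingHom.mem_ker]
    delta fontaineThetaInvertP Localization.awayLift
    rw [IsLocalization.Away.lift_eq, RingHom.comp_apply, fontaineTheta_xi, map_zero]

omit [CharZero F] [Fact p.Prime] [Fact (¬ IsUnit (p : integerC F))] [IsAdicComplete (Ideal.span {(p : integerC F)}) (integerC F)] in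
/-- A principal ideal is finitely generated. [folklore] -/
theorem fg_span_singleton {R : Type*} [CommRing R] (a : R) : (Ideal.span {a} : Ideal R).FG :=
  ⟨{a}, by rw [Finset.coe_singleton]⟩

/-- `ker θ[1/p]` is finitely generated (principal). [folklore] -/
theorem fg_ker_fontaineThetaInvertP : (RingHom.ker (fontaineThetaInvertP (integerC F) p)).FG := by
  rw [ker_fontaineThetaInvertP_eq_span]; exact fg_span_singleton _

/-- **`ker θ[1/p]` is a maximal ideal**: `θ[1/p]` maps onto `𝒪_{ℂ_F}[1/p] ≅ ℂ_F`, a field.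
[cite: FontaineAsterisque223III, Exp. II §1.5] -/
theorem isMaximal_ker_fontaineThetaInvertP (hF : Function.Surjective (fontaineTheta (integerC F) p)) :
    (RingHom.ker (fontaineThetaInvertP (integerC F) p)).IsMaximal := by
  -- compose with `𝒪_{ℂ_F}[1/p] ≃ ℂ_F`
  let e : Localization.Away (p : integerC F) ≃ₐ[integerC F] CompletedAlgClosure F :=
    Localization.algEquiv (Submonoid.powers (p : integerC F)) (CompletedAlgClosure F)
  have hker : RingHom.ker ((e : Localization.Away (p : integerC F) →+* CompletedAlgClosure F).comp
      (fontaineThetaInvertP (integerC F) p)) = RingHom.ker (fontaineThetaInvertP (integerC F) p) :=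
    RingHom.ker_equiv_comp (fontaineThetaInvertP (integerC F) p) e.toRingEquiv
  rw [← hker]
  exact RingHom.ker_isMaximal_of_surjective _ (e.surjective.comp (fontaineThetaInvertP_surjective hF))

/-! ### Consequences for `B_dR⁺` -/

omit [CharZero F] in
/-- `B_dR⁺` (Mathlib `BDeRhamPlus`, which only derives `CommRing`) as an algebra over `𝔸_inf[1/p]`:
the structure map of the adic completion. [folklore] -/
instance instAlgebraBDeRhamPlus :
    Algebra (Localization.Away (p : Ainf (p := p) F)) (BDeRhamPlus (integerC F) p) :=
  inferInstanceAs (Algebra (Localization.Away (p : Ainf (p := p) F))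
    (AdicCompletion (RingHom.ker (fontaineThetaInvertP (integerC F) p)) (Localization.Away (p : Ainf (p := p) F))))

omit [CharZero F] in
/-- The structure map `𝔸_inf[1/p] → B_dR⁺` is `AdicCompletion.of`. [folklore] -/
theorem algebraMap_bDeRhamPlus_apply (x : Localization.Away (p : Ainf (p := p) F)) :
    algebraMap (Localization.Away (p : Ainf (p := p) F)) (BDeRhamPlus (integerC F) p) x =
      AdicCompletion.of (RingHom.ker (fontaineThetaInvertP (integerC F) p)) _ x := rfl

/-- **`B_dR⁺` is `ker θ[1/p]`-adically complete** (Mathlib: adic completions at finitely generated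
ideals are complete). [cite: FontaineAsterisque223III, Exp. II §1.5] -/
theorem isAdicComplete_bDeRhamPlus :
    IsAdicComplete ((RingHom.ker (fontaineThetaInvertP (integerC F) p)).map
      (algebraMap (Localization.Away (p : Ainf (p := p) F)) (BDeRhamPlus (integerC F) p))) (BDeRhamPlus (integerC F) p) :=
  AdicCompletion.isAdicComplete_self _ fg_ker_fontaineThetaInvertP

/-- The ideal of `B_dR⁺` generated by `ker θ[1/p]` is maximal. [cite: FontaineAsterisque223III, Exp. II §1.5] -/
theorem isMaximal_map_ker_bDeRhamPlus (hF : Function.Surjective (fontaineTheta (integerC F) p)) :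
    ((RingHom.ker (fontaineThetaInvertP (integerC F) p)).map
      (algebraMap (Localization.Away (p : Ainf (p := p) F)) (BDeRhamPlus (integerC F) p))).IsMaximal :=
  haveI := isMaximal_ker_fontaineThetaInvertP hF
  AdicCompletion.isMaximal_map_of_le _ _ le_rfl fg_ker_fontaineThetaInvertP

/-- **`B_dR⁺(F)` is a local ring** (complete with respect to a maximal ideal).
[cite: FontaineAsterisque223III, Exp. II §1.5] [cite: FontaineOuyang2022, §5.1] -/
theorem isLocalRing_bDeRhamPlus (hF : Function.Surjective (fontaineTheta (integerC F) p)) :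
    IsLocalRing (BDeRhamPlus (integerC F) p) :=
  haveI := isMaximal_map_ker_bDeRhamPlus (F := F) (p := p) hF
  haveI := isAdicComplete_bDeRhamPlus (F := F) (p := p)
  isLocalRing_of_isAdicComplete_maximal ((RingHom.ker (fontaineThetaInvertP (integerC F) p)).map
      (algebraMap (Localization.Away (p : Ainf (p := p) F)) (BDeRhamPlus (integerC F) p)))

end Away

/-! ### Specialisation to `hp : v(p) < 1` (the instances of `FontaineThetaLocalField`) -/

/-- **`B_dR⁺(F)` is a local ring.** [cite: FontaineAsterisque223III, Exp. II §1.5] -/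
instance instIsLocalRingBdRPlus (hp : valuation F p < 1) : IsLocalRing (BdRPlus F hp) := by
  haveI : Fact (¬ IsUnit (p : integerC F)) := ⟨not_isUnit_natCast_integerC hp⟩
  haveI := isAdicComplete_integerC_natCast hp
  exact isLocalRing_bDeRhamPlus (surjective_fontaineTheta_integerC hp)

end Literature.NumberTheory.PAdicHodge

end
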